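import Literature.NumberTheory.Transcendental.JungFactorExponents
import Literature.NumberTheory.Transcendental.JungFactorForm
import HarnessLib

/-!
# Jung's projection method: the binomial factor clause of one slab chart

Glue between `JungFactorExponents` / `JungFactorForm` and the evaluation identity of the sheared
polynomials: for a slab chart `Ψ(z) = Sh_v(χ(z'), t(z))`, `t(z) = W_K(z') + z_d (W_{K+1} − W_K)(z')`,
over a prepared base chart with root data `(ζ, τ, r, e)` on a box, every polynomial `Q` with
`Q(Sh_v y) = κ · Qh(y', y_d)` for a monic divisor `Qh ∣ Rh` is, along `Ψ`, in the binomial product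
form of the cube-monomialisation skeleton (`exists_factor_clause`). The divisor-lemma consequences
(wall differences and imaginary parts as monomials times units) enter as hypotheses in the shape
produced by `JungRootDifferences.exists_root_differences`. Namespace
`Literature.NumberTheory.Transcendental.JungPreparation`.

## References

* J. Kollár, *Lectures on Resolution of Singularities* (2007), §2.3.
-/

noncomputable section

open Set Polynomial
open scoped ComplexConjugate
open Literature.Analysis.Calculus

namespace Literature.NumberTheory.Transcendental.JungPreparation

variable {d : ℕ}

/-- Evaluating `Qh(x, ·)` at a real `t` and casting to `ℂ` is evaluating the complexified
specialisation at `t`. [folklore] -/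
theorem ofReal_eval_map (Qh : (MvPolynomial (Fin d) ℚ)[X]) (x : Fin d → ℝ) (t : ℝ) :
    (((Qh.map (MvPolynomial.eval₂Hom (algebraMap ℚ ℝ) x)).eval t : ℝ) : ℂ) =
      (Qh.map ((algebraMap ℝ ℂ).comp (MvPolynomial.eval₂Hom (algebraMap ℚ ℝ) x))).eval (t : ℂ) := by
  rw [← Complex.coe_algebraMap, eval_map, eval_map, hom_eval₂]

/-- **The factor clause of a slab chart.** See the module docstring (Kollár 2007, §2.3).
[folklore] -/
theorem exists_factor_clause {n p : ℕ} {δ δ' : ℝ} (hδ : 0 < δ) (hδ' : 0 < δ') (hδ'δ : δ' ≤ δ)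
    {Rh Qh : (MvPolynomial (Fin d) ℚ)[X]} (hRh : Rh.Monic) (hQh : Qh.Monic) (hdvd : Qh ∣ Rh)
    (χ : (Fin d → ℝ) → (Fin d → ℝ))
    (hχa : AnalyticOnNhd ℝ χ (Set.pi Set.univ (fun _ : Fin d => Ioo (-δ) (1 + δ))))
    (ζ : Fin n → (Fin d → ℝ) → ℂ)
    (hζa : ∀ l, AnalyticOnNhd ℝ (ζ l) (Set.pi Set.univ (fun _ : Fin d => Ioo (-δ) (1 + δ))))
    (hinj : ∀ σ ∈ Set.pi Set.univ (fun _ : Fin d => Ioo (0 : ℝ) 1), Function.Injective fun l => ζ l σ)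
    {τ : Fin n → Fin n} (hτinv : Function.Involutive τ)
    (hτ : ∀ l, ∀ σ ∈ Set.pi Set.univ (fun _ : Fin d => Ioo (-δ) (1 + δ)), conj (ζ l σ) = ζ (τ l) σ)
    {r : Fin p → Fin n} (hrinj : Function.Injective r) (hrfix : ∀ m, τ (r m) = r m)
    (hrsurj : ∀ l, τ l = l → ∃ m, r m = l)
    {e : Fin n → ℕ}
    (he : ∀ σ ∈ Set.pi Set.univ (fun _ : Fin d => Ioo (-δ) (1 + δ)),
      Rh.map ((algebraMap ℝ ℂ).comp (MvPolynomial.eval₂Hom (algebraMap ℚ ℝ) (χ σ))) =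
        ∏ l, (X - C (ζ l σ)) ^ e l)
    (hwall : ∀ l, 0 < e l → ∃ m, ∀ σ ∈ Set.pi Set.univ (fun _ : Fin d => Ioo (-δ) (1 + δ)),
      ((ζ l σ).re : ℂ) = ζ (r m) σ)
    (hdiff : ∀ m m' : Fin p, m < m' → ∃ (β : Fin d → ℕ) (u : (Fin d → ℝ) → ℝ),
      AnalyticOnNhd ℝ u (Set.pi Set.univ (fun _ : Fin d => Ioo (-δ') (1 + δ'))) ∧
      (∀ σ ∈ Set.pi Set.univ (fun _ : Fin d => Ioo (-δ') (1 + δ')), 0 < u σ) ∧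
      ∀ σ ∈ Set.pi Set.univ (fun _ : Fin d => Ioo (-δ') (1 + δ')),
        (ζ (r m') σ).re - (ζ (r m) σ).re = (∏ i, σ i ^ β i) * u σ)
    (him : ∀ l, τ l ≠ l → ∃ (β : Fin d → ℕ) (w : (Fin d → ℝ) → ℝ),
      AnalyticOnNhd ℝ w (Set.pi Set.univ (fun _ : Fin d => Ioo (-δ') (1 + δ'))) ∧
      (∀ σ ∈ Set.pi Set.univ (fun _ : Fin d => Ioo (-δ') (1 + δ')), w σ ≠ 0) ∧
      ∀ σ ∈ Set.pi Set.univ (fun _ : Fin d => Ioo (-δ') (1 + δ')), (ζ l σ).im = (∏ i, σ i ^ β i) * w σ)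
    {Q : MvPolynomial (Fin (d + 1)) ℚ} {κ : ℚ} (hκ : κ ≠ 0) (Sh : (Fin (d + 1) → ℝ) → (Fin (d + 1) → ℝ))
    (hQeval : ∀ y : Fin (d + 1) → ℝ, MvPolynomial.aeval (Sh y) Q =
      algebraMap ℚ ℝ κ * ((Qh.map (MvPolynomial.eval₂Hom (algebraMap ℚ ℝ) (Fin.init y))).eval (y (Fin.last d))))
    {K : ℕ} (hK : K + 1 < p) (Ψ : (Fin (d + 1) → ℝ) → (Fin (d + 1) → ℝ))
    (hΨ : ∀ z, Ψ z = Sh (Fin.snoc (χ (Fin.init z)) ((ζ (r ⟨K, Nat.lt_of_succ_lt hK⟩) (Fin.init z)).re +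
      z (Fin.last d) * ((ζ (r ⟨K + 1, hK⟩) (Fin.init z)).re - (ζ (r ⟨K, Nat.lt_of_succ_lt hK⟩) (Fin.init z)).re)))) :
    ∃ U : Set (Fin (d + 1) → ℝ), IsOpen U ∧ Set.pi Set.univ (fun _ : Fin (d + 1) => Set.Icc (0:ℝ) 1) ⊆ U ∧
      ∃ (a₀ b₀ : Fin (d + 1) → ℕ) (e₀ : (Fin (d + 1) → ℝ) → ℝ) (L₁ L₂ : ℕ) (m₁ : Fin L₁ → ℕ)
        (a₁ b₁ a₂ b₂ : Fin L₁ → Fin (d + 1) → ℕ) (e₁ e₂ : Fin L₁ → (Fin (d + 1) → ℝ) → ℝ)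
        (m₂ : Fin L₂ → ℕ) (a₃ b₃ a₄ b₄ a₅ b₅ : Fin L₂ → Fin (d + 1) → ℕ)
        (e₃ e₄ e₅ : Fin L₂ → (Fin (d + 1) → ℝ) → ℝ),
        AnalyticOnNhd ℝ e₀ U ∧ (∀ x ∈ U, e₀ x ≠ 0) ∧
        (∀ l, AnalyticOnNhd ℝ (e₁ l) U ∧ AnalyticOnNhd ℝ (e₂ l) U ∧ ∀ x ∈ U, 0 < e₁ l x ∧ 0 < e₂ l x) ∧
        (∀ l, AnalyticOnNhd ℝ (e₃ l) U ∧ AnalyticOnNhd ℝ (e₄ l) U ∧ AnalyticOnNhd ℝ (e₅ l) U ∧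
          ∀ x ∈ U, 0 < e₃ l x ∧ 0 < e₄ l x ∧ 0 < e₅ l x) ∧
        ∀ x ∈ U, (fun x => MvPolynomial.aeval (Ψ x) Q) x =
          (∏ i, x i ^ a₀ i * (1 - x i) ^ b₀ i) * e₀ x *
            (∏ l, ((∏ i, x i ^ a₁ l i * (1 - x i) ^ b₁ l i) * e₁ l x +
              (∏ i, x i ^ a₂ l i * (1 - x i) ^ b₂ l i) * e₂ l x) ^ m₁ l) *
            ∏ l, (((∏ i, x i ^ a₃ l i * (1 - x i) ^ b₃ l i) * e₃ l x +
              (∏ i, x i ^ a₄ l i * (1 - x i) ^ b₄ l i) * e₄ l x) ^ 2 +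
              (∏ i, x i ^ a₅ l i * (1 - x i) ^ b₅ l i) * e₅ l x) ^ m₂ l := by
  classical
  set Bx := Set.pi Set.univ (fun _ : Fin d => Ioo (-δ) (1 + δ)) with hBx
  set Bx' := Set.pi Set.univ (fun _ : Fin d => Ioo (-δ') (1 + δ')) with hBx'
  have hB'B : Bx' ⊆ Bx := Set.pi_mono fun _ _ => Ioo_subset_Ioo (by linarith) (by linarith)
  have hp : 0 < p := by omega
  -- ### exponents of `Qh`
  obtain ⟨k, hk, hkτ, hke⟩ := exists_divisor_exponents hδ hRh hQh hdvd χ hχa ζ hζa hinj hτinv hτ he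
  -- ### walls and the wall assignment of the occurring non-real roots
  set W : Fin p → (Fin d → ℝ) → ℝ := fun m σ => (ζ (r m) σ).re with hWdef
  have hwall' : ∀ l, ∃ m : Fin p, 0 < e l → ∀ σ ∈ Bx, ((ζ l σ).re : ℂ) = ζ (r m) σ := fun l => by
    by_cases h : 0 < e l
    · obtain ⟨m, hm⟩ := hwall l h
      exact ⟨m, fun _ => hm⟩
    · exact ⟨⟨0, hp⟩, fun h' => (h h').elim⟩
  choose μ hμ using hwall'
  have hμ' : ∀ l, τ l ≠ l → 0 < k l → ∀ σ ∈ Bx', (ζ l σ).re = W (μ l) σ := by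
    intro l _ hkl σ hσ
    have h := hμ l (lt_of_lt_of_le hkl (hke l)) σ (hB'B hσ)
    have h2 := congrArg Complex.re h
    rw [Complex.ofReal_re] at h2
    exact h2
  -- ### difference and imaginary data as total functions
  choose βd₀ ud₀ huda₀ hudpos₀ hud₀ using hdiff
  choose βi₀ vi₀ hvia₀ hvi0₀ hvi₀ using him
  set βd : Fin p → Fin p → Fin d → ℕ := fun m m' => if h : m < m' then βd₀ m m' h else 0 with hβd
  set ud : Fin p → Fin p → (Fin d → ℝ) → ℝ := fun m m' => if h : m < m' then ud₀ m m' h else 0 with hud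
  set βi : Fin n → Fin d → ℕ := fun l => if h : τ l ≠ l then βi₀ l h else 0 with hβi
  set vi : Fin n → (Fin d → ℝ) → ℝ := fun l => if h : τ l ≠ l then vi₀ l h else 0 with hvi
  obtain ⟨U, hUo, hcubeU, a₀, b₀, e₀, L₁, L₂, m₁, a₁, b₁, a₂, b₂, e₁, e₂, m₂, a₃, b₃, a₄, b₄, a₅, b₅,
    e₃, e₄, e₅, he₀a, he₀0, h1, h2, hid⟩ :=
    exists_binomial_form (d := d) hδ' ζ hτinv (fun l σ hσ => hτ l σ (hB'B hσ)) hrinj hrfix hrsurj W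
      (fun m σ _ => rfl) hkτ μ hμ' βd ud
      (fun m m' h => by simp only [hud, h, dif_pos]; exact huda₀ m m' h)
      (fun m m' h σ hσ => by simp only [hud, h, dif_pos]; exact hudpos₀ m m' h σ hσ)
      (fun m m' h σ hσ => by simp only [hud, hβd, h, dif_pos]; exact hud₀ m m' h σ hσ)
      βi vi (fun l h => by simp only [hvi, h, ne_eq, not_false_eq_true, dif_pos]; exact hvia₀ l h)
      (fun l h σ hσ => by simp only [hvi, h, ne_eq, not_false_eq_true, dif_pos]; exact hvi0₀ l h σ hσ)
      (fun l h σ hσ => by simp only [hvi, hβi, h, ne_eq, not_false_eq_true, dif_pos]; exact hvi₀ l h σ hσ)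
      (algebraMap ℚ ℝ κ) (by simpa using hκ) hK
  -- ### restrict to the cylinder over the small box and translate `y`
  obtain ⟨hVo, -⟩ := isOpen_setOf_init_mem_box (d := d) hδ'
  set U' := U ∩ {z : Fin (d + 1) → ℝ | Fin.init z ∈ Bx'} with hU'
  have hU'U : U' ⊆ U := inter_subset_left
  refine ⟨U', hUo.inter hVo, fun z hz => ⟨hcubeU hz, (isOpen_setOf_init_mem_box (d := d) hδ').2 hz⟩,
    a₀, b₀, e₀, L₁, L₂, m₁, a₁, b₁, a₂, b₂, e₁, e₂, m₂, a₃, b₃, a₄, b₄, a₅, b₅, e₃, e₄, e₅,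
    he₀a.mono hU'U, fun x hx => he₀0 x (hU'U hx),
    fun l => ⟨(h1 l).1.mono hU'U, (h1 l).2.1.mono hU'U, fun x hx => (h1 l).2.2 x (hU'U hx)⟩,
    fun l => ⟨(h2 l).1.mono hU'U, (h2 l).2.1.mono hU'U, (h2 l).2.2.1.mono hU'U,
      fun x hx => (h2 l).2.2.2 x (hU'U hx)⟩, fun x hx => ?_⟩
  simp only
  rw [hΨ, hQeval, Fin.init_snoc, Fin.snoc_last]
  refine hid x (hU'U hx) _ ?_
  rw [ofReal_eval_map, hk _ (hB'B hx.2), eval_prod]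
  simp only [eval_pow, eval_sub, eval_X, eval_C, hWdef]

end Literature.NumberTheory.Transcendental.JungPreparation
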